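import Literature.AlgebraicGeometry.Resolution.RegularFormalFibres
import Mathlib.RingTheory.Flat.Stability
import HarnessLib

/-!
# A fibre over a height-one prime is regular when a derivation detects a generator
# (the `d/dx`-step of Stacks 07PU, via Matsumura Thm. 30.4 (ii))

Topic: `Literature/AlgebraicGeometry/Resolution`. The last step of the proof of The Stacks
Project, Tag 07PU (Lemma 15.51.9, the case `𝔯 ≠ (0)` of Grothendieck's theorem 07PV on
polynomial rings over complete local rings): "In this case we see that `𝔯K[x]` is generated by
`x - f` for some `f ∈ K` and `A[x]_𝔮^∧ ⊗_{A[x]} κ(𝔯) = (A[x]_𝔮^∧ ⊗_A K)/(x - f)`. The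
derivation `D = d/dx` of `A[x]` extends to `K[x]` and maps `x - f` to a unit of `K[x]`. Moreover
`D` extends to `A[x]_𝔮^∧ ⊗_A K` by Lemma 15.49.1. … We conclude by Lemma 15.49.2 [07PF]."
We isolate it in a form usable both in characteristic `0` (where `𝔯K[x] = (g)` with `g`
separable, so `g'` is a unit modulo `g`) and in characteristic `p` (07PU proper), and we replace
07PF by the sharper Matsumura Thm. 30.4 (ii) (PROVED in `JacobianCriterion.lean`), which also
yields `𝔯S_𝔔 = gS_𝔔`:

Let `T` be a Noetherian ring, `Q` a prime, `R = T_Q`, `S` a Noetherian `R`-algebra flat over `T`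
(e.g. `S = (T_Q)^`), `𝔯 ⊆ Q` a prime of height one (and `𝔭 = 𝔯R` the prime of `R` over it), `g ∈ 𝔯`, and `D` a derivation of `S` such
that `v · D(g) ≡ c (mod gS)` for some `v ∈ S` and some `c ∈ T ∖ 𝔯`. If `S_𝔔` is a regular local
ring for every prime `𝔔` of `S` over `𝔯R`, then the fibre ring `κ(𝔯R) ⊗_R S` of `R → S` over
`𝔯R` is a regular ring. Proof: for such `𝔔`, `c ∉ 𝔔` (as `𝔔 ∩ T = 𝔯`), hence `D(g) ∉ 𝔔`;
`ht 𝔯S_𝔔 = ht 𝔯 = 1` by going down along the flat `T → S_𝔔`; so Thm. 30.4 (ii) with `r = 1`,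
`f_1 = g`, `D_1 = D` gives `S_𝔔/𝔯S_𝔔` regular; these are the local rings of the fibre ring
(`isRegularRing_fiber_of_forall`). Everything is PROVED; no new notions, no named facts.

## Sources

* The Stacks Project, Tag 07PU (Lemma 15.51.9), proof; Tag 07PF (Lemma 15.49.2).
  [StacksProject]
* H. Matsumura, *Commutative Ring Theory*, CUP 1986, Thm. 30.4 (ii), p. 233; Thm. 15.1.
  [Matsumura1987]
-/

noncomputable section

open IsLocalRing

namespace Literature.AlgebraicGeometry.Resolution

universe u

/-- **The fibre over a height-one prime `𝔯` is regular when a derivation detects a generator**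
(the `d/dx`-step of Stacks 07PU, through Matsumura Thm. 30.4 (ii)); see the module docstring for
the statement and proof. [cite: StacksProject, Tag 07PU (proof)] -/
theorem isRegularRing_fiber_of_derivation {T : Type u} [CommRing T] [IsNoetherianRing T]
    (Q : Ideal T) [Q.IsPrime] (S : Type u) [CommRing S] [IsNoetherianRing S] [Algebra T S]
    [Algebra (Localization.AtPrime Q) S] [IsScalarTower T (Localization.AtPrime Q) S]
    [Module.Flat T S] (r : Ideal T) [r.IsPrime] (hht : r.height = 1) (g : T)
    (hg : g ∈ r) (D : Derivation ℤ S S)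
    (hD : ∃ (v : S) (c : T), c ∉ r ∧
      v * D (algebraMap T S g) - algebraMap T S c ∈ Ideal.span {algebraMap T S g})
    (p : Ideal (Localization.AtPrime Q)) [p.IsPrime]
    (hpr : p.comap (algebraMap T (Localization.AtPrime Q)) = r)
    (hreg : ∀ (𝔔 : Ideal S) [𝔔.IsPrime], 𝔔.under (Localization.AtPrime Q) = p →
      IsRegularLocalRing (Localization.AtPrime 𝔔)) :
    IsRegularRing (p.Fiber S) := by
  classical
  set R := Localization.AtPrime Q
  -- `p = 𝔯R`
  have hp : r.map (algebraMap T R) = p := by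
    rw [← hpr, ← Ideal.under_def]
    exact IsLocalization.map_under Q.primeCompl R p
  obtain ⟨v, c, hc, hvc⟩ := hD
  refine isRegularRing_fiber_of_forall p fun 𝔔 _ h𝔔 => ?_
  haveI : IsRegularLocalRing (Localization.AtPrime 𝔔) := hreg 𝔔 h𝔔
  set A := Localization.AtPrime 𝔔
  -- `I = 𝔯S ⊆ 𝔔`
  set I : Ideal S := r.map (algebraMap T S) with hI
  have hIp : I = p.map (algebraMap R S) := by
    rw [← hp, Ideal.map_map, ← IsScalarTower.algebraMap_eq T R S]
  have hI𝔔 : I ≤ 𝔔 := by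
    rw [hIp, Ideal.map_le_iff_le_comap, ← Ideal.under_def, h𝔔]
  have hgI : algebraMap T S g ∈ I := Ideal.mem_map_of_mem _ hg
  -- flatness of `T → S → S_𝔔`, so `ht 𝔯S_𝔔 = ht 𝔯 = 1`
  haveI : Module.Flat T A := Module.Flat.trans T S A
  have hmapA : I.map (algebraMap S A) = r.map (algebraMap T A) := by
    rw [hI, Ideal.map_map, ← IsScalarTower.algebraMap_eq T S A]
  have hne : r.map (algebraMap T A) ≠ ⊤ := by
    intro htop
    have hle : r.map (algebraMap T A) ≤ maximalIdeal A := by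
      rw [← hmapA, ← Localization.AtPrime.map_eq_maximalIdeal]
      exact Ideal.map_mono hI𝔔
    exact (maximalIdeal.isMaximal A).ne_top (top_le_iff.mp (htop ▸ hle))
  have hrA : (I.map (algebraMap S A)).height = 1 := by
    rw [hmapA, height_map_eq_of_hasGoingDown r hne, hht]
  -- `D(g) ∉ 𝔔`: otherwise `c ∈ 𝔔 ∩ T = 𝔯`
  have hDg : D (algebraMap T S g) ∉ 𝔔 := by
    intro hDg
    apply hc
    have h1 : v * D (algebraMap T S g) - algebraMap T S c ∈ 𝔔 :=
      (Ideal.span_le.mpr (Set.singleton_subset_iff.mpr (hI𝔔 hgI))) hvc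
    have h2 : algebraMap T S c ∈ 𝔔 := by
      have h := 𝔔.sub_mem (𝔔.mul_mem_left v hDg) h1
      rwa [sub_sub_cancel] at h
    have h3 : algebraMap T R c ∈ p := by
      rw [← h𝔔, Ideal.under_def, Ideal.mem_comap, ← IsScalarTower.algebraMap_apply]
      exact h2
    rw [← hpr, Ideal.mem_comap]
    exact h3
  have hdet : (Matrix.of fun (_ : Fin 1) (_ : Fin 1) => D (algebraMap T S g)).det ∉ 𝔔 := by
    rwa [Matrix.det_unique, Matrix.of_apply]
  -- Matsumura Thm. 30.4 (ii) with `r = 1`, `f₁ = g`, `D₁ = D`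
  have key := map_eq_span_and_isRegularLocalRing_quotient_of_det_not_mem 𝔔 A I hI𝔔 1 hrA
    (fun _ => D) (fun _ => algebraMap T S g) (fun _ => hgI) hdet
  have hmaps : p.map (algebraMap R A) = I.map (algebraMap S A) := by
    rw [hIp, Ideal.map_map, ← IsScalarTower.algebraMap_eq R S A]
  rw [hmaps]
  exact key.2

end Literature.AlgebraicGeometry.Resolution

end
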